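import Mathlib.Probability.Martingale.OptionalSampling
import Mathlib.MeasureTheory.Function.ConditionalExpectation.Real
import Mathlib.Analysis.Complex.Basic
import HarnessLib

/-!
# Tails of a Doob martingale at a stopping time (uniform integrability of conditional expectations)

Topic `Literature/Probability/Process`; theorems only. The elementary estimate behind "conditional
expectations of a uniformly integrable family are uniformly integrable" (Williams, *Probability
with Martingales* (1991), Thm. 13.4; Kallenberg (2021), Lemma 5.10 with Thm. 9.24), in the
quantitative form consumed when the martingale property of a DISCRETE Doob martingale
`n ↦ E[X ∣ 𝒢_n]` of a nonnegative terminal variable `X` (e.g. the expected terminal "room" of an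
interior point given the first `n` steps of a self-avoiding polymer) is passed to a scaling limit:
on an exceptional event `E` of small probability the stopped value `E[X ∣ 𝒢_σ]` has a small
integral, uniformly in the scale, as soon as the terminal variables have uniformly small tails.

* `setIntegral_abs_condExp_le_of_nonneg` — for `X ≥ 0` integrable, any sub-σ-algebra `m`, any
  set `E` and level `R ≥ 0`: `∫_E |E[X|m]| ≤ R μ(E) + ∫_{X > R} X`
  (`E[X|m] ≤ R + E[(X - R)⁺|m]`);
* `martingale_of_ae_eq_const_mul_condExp` — a strongly adapted process a.e. equal to
  `κ · E[X ∣ 𝒢_n]` at every `n` is a martingale;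
* `setIntegral_abs_stoppedValue_le_of_ae_eq_condExp` — for such a process `G` and a bounded
  stopping time `σ`: `∫_E |G_σ| ≤ |κ| (R μ(E) + ∫_{X > R} X)` (optional sampling
  `G_σ = E[G_M ∣ 𝒢_σ]`, tower property, and the first estimate);
* `martingale_ofReal` — the complexification `n ↦ (G_n : ℂ)` of a real martingale is a
  (complex) martingale (conditional expectation commutes with the continuous linear map `ℝ → ℂ`).

No definitions, no named facts; Mathlib only (`condExp_mono`, `condExp_nonneg`, `condExp_add`,
`Martingale.stoppedValue_ae_eq_condExp_of_le`, `condExp_condExp_of_le`,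
`ContinuousLinearMap.comp_condExp_comm`).

## References

* D. Williams, *Probability with Martingales*, CUP (1991), §13.1, Thm. 13.4, §14.1.
* O. Kallenberg, *Foundations of Modern Probability*, 3rd ed. (2021), Lemma 5.10, Thm. 9.24,
  Thm. 7.12 (optional sampling).
-/

noncomputable section

open MeasureTheory Filter Set
open scoped ENNReal

namespace Literature.Probability.Process

variable {Ω : Type*} {m m₀ : MeasurableSpace Ω} {μ : Measure Ω}

/-- **Tail estimate for a conditional expectation.** For a finite measure, a measurable
integrable `X ≥ 0`, a sub-σ-algebra `m ≤ m₀`, any set `E` and any level `R ≥ 0`: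
`∫_E |μ[X|m]| dμ ≤ R · μ(E) + ∫_{X > R} X dμ`. Proof: `X = X ∧ R + (X - R)⁺`, so
`0 ≤ μ[X|m] ≤ R + μ[(X - R)⁺|m]` a.e.; integrate over `E`, bound `∫_E μ[(X-R)⁺|m] ≤ ∫ μ[(X-R)⁺|m]
= ∫ (X - R)⁺ ≤ ∫_{X > R} X`. [folklore] -/
theorem setIntegral_abs_condExp_le_of_nonneg [IsFiniteMeasure μ] (hm : m ≤ m₀) {X : Ω → ℝ}
    (hXm : Measurable X) (hX0 : ∀ ω, 0 ≤ X ω) (hX : Integrable X μ) (E : Set Ω) {R : ℝ}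
    (hR : 0 ≤ R) :
    ∫ ω in E, |(μ[X | m]) ω| ∂μ ≤ R * μ.real E + ∫ ω in {ω | R < X ω}, X ω ∂μ := by
  set Y : Ω → ℝ := fun ω ↦ min (X ω) R with hYdef
  set V : Ω → ℝ := fun ω ↦ X ω - min (X ω) R with hVdef
  have hYi : Integrable Y μ := hX.inf (integrable_const R)
  have hVi : Integrable V μ := hX.sub hYi
  have hXYV : X = Y + V := by
    ext ω
    simp [hYdef, hVdef]
  have h1 : μ[X | m] =ᵐ[μ] μ[Y | m] + μ[V | m] := by
    rw [hXYV]
    exact condExp_add hYi hVi m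
  have h2 : μ[Y | m] ≤ᵐ[μ] fun _ ↦ R := by
    have h := condExp_mono (m := m) hYi (integrable_const R)
      (ae_of_all μ (fun ω ↦ min_le_right (X ω) R))
    rwa [condExp_const hm] at h
  have h3 : 0 ≤ᵐ[μ] μ[V | m] :=
    condExp_nonneg (ae_of_all μ fun ω ↦ sub_nonneg.2 (min_le_left (X ω) R))
  have h0 : 0 ≤ᵐ[μ] μ[X | m] := condExp_nonneg (ae_of_all μ hX0)
  have h4 : ∀ᵐ ω ∂μ, |(μ[X | m]) ω| ≤ R + (μ[V | m]) ω := by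
    filter_upwards [h0, h1, h2, h3] with ω hω0 hω1 hω2 hω3
    rw [abs_of_nonneg hω0, hω1, Pi.add_apply]
    linarith
  have hset : MeasurableSet {ω | R < X ω} := measurableSet_lt measurable_const hXm
  calc ∫ ω in E, |(μ[X | m]) ω| ∂μ ≤ ∫ ω in E, (R + (μ[V | m]) ω) ∂μ :=
        setIntegral_mono_ae integrable_condExp.abs.integrableOn
          ((integrable_const R).add integrable_condExp).integrableOn h4
    _ = R * μ.real E + ∫ ω in E, (μ[V | m]) ω ∂μ := by
        rw [integral_add (integrable_const R).integrableOn integrable_condExp.integrableOn,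
          setIntegral_const, smul_eq_mul, mul_comm]
    _ ≤ R * μ.real E + ∫ ω, (μ[V | m]) ω ∂μ :=
        add_le_add le_rfl (setIntegral_le_integral (s := E) integrable_condExp h3)
    _ = R * μ.real E + ∫ ω, V ω ∂μ := by rw [integral_condExp hm]
    _ ≤ R * μ.real E + ∫ ω in {ω | R < X ω}, X ω ∂μ := by
        gcongr
        rw [← integral_indicator hset]
        refine integral_mono hVi (hX.indicator hset) fun ω ↦ ?_
        simp only [hVdef, Set.indicator_apply, mem_setOf_eq]
        split_ifs with h
        · rw [min_eq_right h.le]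
          linarith
        · rw [not_lt] at h
          rw [min_eq_left h, sub_self]

/-- **A process a.e. equal to `κ · E[X ∣ 𝒢_n]` at every step is a martingale** (it is a version of
a scalar multiple of the Doob martingale `martingale_condExp`). [folklore] -/
theorem martingale_of_ae_eq_const_mul_condExp [IsFiniteMeasure μ] {𝒢 : Filtration ℕ m₀}
    {X : Ω → ℝ} {G : ℕ → Ω → ℝ} (κ : ℝ) (hGad : StronglyAdapted 𝒢 G)
    (hG : ∀ n, G n =ᵐ[μ] fun ω ↦ κ * (μ[X | 𝒢 n]) ω) : Martingale G 𝒢 μ := by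
  refine ((martingale_condExp X 𝒢 μ).smul κ).congr hGad fun n ↦ ?_
  filter_upwards [hG n] with ω hω
  rw [hω, Pi.smul_apply, Pi.smul_apply, smul_eq_mul]

/-- **Tails of a Doob martingale at a bounded stopping time.** Let `G` be strongly adapted with
`G_n = κ · E[X ∣ 𝒢_n]` a.e. for every `n`, where `X ≥ 0` is measurable and integrable, and let `σ`
be a stopping time bounded by `M`. Then for every set `E` and level `R ≥ 0`,
`∫_E |G_σ| ≤ |κ| (R μ(E) + ∫_{X > R} X)`: by optional sampling `G_σ = E[G_M ∣ 𝒢_σ]` a.e., by the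
tower property this is `κ E[X ∣ 𝒢_σ]`, and `setIntegral_abs_condExp_le_of_nonneg` applies to the
stopped σ-algebra. This is the quantitative content of "`{E[X ∣ 𝒢_σ]}` is uniformly integrable"
used to control the exceptional event when passing a discrete Doob martingale to a scaling limit.
[folklore] -/
theorem setIntegral_abs_stoppedValue_le_of_ae_eq_condExp [IsFiniteMeasure μ]
    {𝒢 : Filtration ℕ m₀} {X : Ω → ℝ} (hXm : Measurable X) (hX0 : ∀ ω, 0 ≤ X ω)
    (hX : Integrable X μ) {G : ℕ → Ω → ℝ} {κ : ℝ} (hGad : StronglyAdapted 𝒢 G)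
    (hG : ∀ n, G n =ᵐ[μ] fun ω ↦ κ * (μ[X | 𝒢 n]) ω) {σ : Ω → WithTop ℕ}
    (hσ : IsStoppingTime 𝒢 σ) {M : ℕ} (hσM : ∀ ω, σ ω ≤ M) (E : Set Ω) {R : ℝ} (hR : 0 ≤ R) :
    ∫ ω in E, |stoppedValue G σ ω| ∂μ ≤
      |κ| * (R * μ.real E + ∫ ω in {ω | R < X ω}, X ω ∂μ) := by
  have hmart : Martingale G 𝒢 μ := martingale_of_ae_eq_const_mul_condExp κ hGad hG
  have hle : hσ.measurableSpace ≤ m₀ := hσ.measurableSpace_le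
  have hleM : hσ.measurableSpace ≤ 𝒢 M := hσ.measurableSpace_le_of_le_const hσM
  -- optional sampling with the constant time `M`
  have hos : stoppedValue G σ =ᵐ[μ] μ[G M | hσ.measurableSpace] := by
    have h := hmart.stoppedValue_ae_eq_condExp_of_le (isStoppingTime_const 𝒢 M) hσ
      (fun ω ↦ hσM ω) (fun _ ↦ le_rfl)
    simpa only [stoppedValue_const] using h
  -- tower property
  have htower : μ[G M | hσ.measurableSpace] =ᵐ[μ] fun ω ↦ κ * (μ[X | hσ.measurableSpace]) ω := by
    have h1 : μ[G M | hσ.measurableSpace] =ᵐ[μ] μ[fun ω ↦ κ * (μ[X | 𝒢 M]) ω | hσ.measurableSpace] :=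
      condExp_congr_ae (hG M)
    have h2 : μ[fun ω ↦ κ * (μ[X | 𝒢 M]) ω | hσ.measurableSpace] =ᵐ[μ]
        κ • μ[μ[X | 𝒢 M] | hσ.measurableSpace] := by
      have := condExp_smul (m := hσ.measurableSpace) (μ := μ) κ (μ[X | 𝒢 M])
      exact this
    have h3 : μ[μ[X | 𝒢 M] | hσ.measurableSpace] =ᵐ[μ] μ[X | hσ.measurableSpace] :=
      condExp_condExp_of_le hleM (𝒢.le M)
    filter_upwards [h1, h2, h3] with ω hω1 hω2 hω3
    rw [hω1, hω2, Pi.smul_apply, hω3, smul_eq_mul]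
  have habs : ∀ᵐ ω ∂μ, |stoppedValue G σ ω| = |κ| * |(μ[X | hσ.measurableSpace]) ω| := by
    filter_upwards [hos, htower] with ω hω1 hω2
    rw [hω1, hω2, abs_mul]
  have hint : Integrable (fun ω ↦ |κ| * |(μ[X | hσ.measurableSpace]) ω|) μ :=
    (integrable_condExp.abs).const_mul _
  calc ∫ ω in E, |stoppedValue G σ ω| ∂μ = ∫ ω in E, |κ| * |(μ[X | hσ.measurableSpace]) ω| ∂μ :=
        integral_congr_ae (ae_restrict_of_ae habs)
    _ = |κ| * ∫ ω in E, |(μ[X | hσ.measurableSpace]) ω| ∂μ := integral_const_mul _ _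
    _ ≤ |κ| * (R * μ.real E + ∫ ω in {ω | R < X ω}, X ω ∂μ) := by
        gcongr
        exact setIntegral_abs_condExp_le_of_nonneg hle hXm hX0 hX E hR

/-- **The complexification of a real martingale is a martingale** (`n ↦ (G_n : ℂ)`; the
conditional expectation commutes with the continuous `ℝ`-linear map `Complex.ofRealCLM`).
[folklore] -/
theorem martingale_ofReal {ι : Type*} [Preorder ι] {𝒢 : Filtration ι m₀} {G : ι → Ω → ℝ}
    (hG : Martingale G 𝒢 μ) : Martingale (fun n ω ↦ (G n ω : ℂ)) 𝒢 μ := by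
  refine ⟨fun n ↦ (Complex.continuous_ofReal.comp_stronglyMeasurable (hG.stronglyAdapted n)),
    fun i j hij ↦ ?_⟩
  have h2 := (Complex.ofRealCLM.comp_condExp_comm (μ := μ) (m := 𝒢 i) (hG.integrable j)).symm
  change μ[Complex.ofRealCLM ∘ G j | 𝒢 i] =ᵐ[μ] Complex.ofRealCLM ∘ G i
  refine h2.trans ?_
  filter_upwards [hG.2 i j hij] with ω hω
  simp only [Function.comp_apply, Complex.ofRealCLM_apply]
  rw [← hω]

end Literature.Probability.Process

end
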